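import Summits.HodgeConjecture.HodgeConjecture.Theses.HeckePrymWeil
import Summits.HodgeConjecture.HodgeConjecture.Theorems.HeckePrymWeilWeilVariationalHodgeBaseReduction
import Summits.HodgeConjecture.HodgeConjecture.Theorems.HeckePrymWeilWeilVariationalHodgeAffineReduction
import Summits.HodgeConjecture.HodgeConjecture.Theorems.AnchorTransportVariationalHodgeReductions
import Summits.HodgeConjecture.HodgeConjecture.Theorems.AnchorTransportVariationalHodgeQuasiProjective

/-!
# Route HeckePrymWeil — `WeilVariationalHodge` (stmt-HodgeConjecture-14497): the crux as typed versus its engine-typed core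

The crux `HeckePrymWeil.WeilVariationalHodge` quantifies over smooth PROPER families `f : 𝒳 ⟶ S` with
projective fibres (`Motives.IsSmoothProjectiveFamily f (2M)`) over an ARBITRARY smooth irreducible
`ℂ`-scheme `S`, whereas every engine of the tree (`Andre1996_deformation`,
`charlesSchnell_algebraicityLocus_iUnion_closed`, `deligne_globalInvariantCycles`) is about families that
are PROJECTIVE in Hartshorne's sense (`𝒳 ↪ ℙᴺ × S` a closed `S`-immersion) over a quasi-projective (here:
affine) base. This file records, sorry-free and unconditionally, how far apart the two are for THIS crux
(line `Sketch`, skeleton v2, lead c1; the generic pattern is the stmt-1076 lead's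
`AnchorTransportVariationalHodgeReductions` / `…QuasiProjective`):

* `weilRung_step_of_affine_of_stable`, `weilRung_of_affine_of_stable` — the Weil rung `(p, M)` for
  families with an extra property `Q` stable under restriction to opens of the base reduces to smooth
  irreducible AFFINE bases (`Q = ⊤` is the landed `stub_affineReduction`, p138186);
* `weilRung_quasiProjective_iff_core` — **the rung restricted to quasi-projective total spaces (over all
  smooth irreducible bases) is EQUIVALENT to the engine-typed core** (H-projective families over smooth
  irreducible affine bases): a proper family with quasi-projective total space is H-projective
  (`exists_isClosedImmersion_of_isSmoothProjectiveFamily`), and conversely over an affine base an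
  H-projective family has quasi-projective total space (`isQuasiProjectiveOver_of_isClosedImmersion_of_isAffine`);
* `weilVariationalHodge_iff_affineRung` — **the crux as typed is equivalent to its restriction to affine
  bases** (no loss in restating it over affine, hence separated quasi-compact quasi-projective, bases);
* `projectiveCore_of_weilVariationalHodge` — the crux as typed implies the core;
* `weilVariationalHodge_of_projectiveCore`, `weilVariationalHodge_iff_projectiveCore` — the converse,
  GRANTED quasi-projectivity of the total spaces of smooth proper families with abelian complex fibres over
  smooth irreducible affine bases (hypothesis `hqp`; true on paper — étale-local sections, abelian schemes
  over a normal base are projective (Raynaud 1970 XI 1.4 = Görtz–Wedhorn II Thm. 27.291), homogeneous spaces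
  are quasi-projective (Raynaud V 3.10 = GW II Thm. 27.71) — but not in the tree; for the general smooth
  proper families of stmt-1076 the same hypothesis is FALSE, Atiyah-flop families).

So the whole difference between the crux as typed and the statement the printed engines address is the single
hypothesis `hqp`, and the crux restricted to quasi-projective total spaces is exactly the core.
-/

noncomputable section

-- every declaration of this problem lives in `Summit.HodgeConjecture.HodgeConjecture.…` (summit = sub-problem)
set_option linter.dupNamespace false

open CategoryTheory AlgebraicGeometry TopologicalSpace MonoidalCategory
open Literature.AlgebraicGeometry.Motives Literature.AlgebraicGeometry.HodgeTheory
open Summit.HodgeConjecture.HodgeConjecture.Theses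

namespace Summit.HodgeConjecture.HodgeConjecture.Theorems

/-! ### Reduction to affine bases for `Q`-families -/

/-- **One step inside an affine open, for `Q`-families** (`Q` stable under base change along open
immersions of the base; `Q = ⊤` is `weilRung_step_of_affine`). If the Weil rung `(p, M)` holds for
`Q`-families over smooth irreducible AFFINE bases, then for a `Q`-family over a smooth irreducible `S`
algebraicity of `W|_{𝒳_a}` passes to `W|_{𝒳_b}` whenever `pt a`, `pt b` lie in a common affine open
`U ⊆ S` (restrict to `U`, move hypotheses / Weil fibres / anchor, apply the affine rung, move back).
[folklore] -/
theorem weilRung_step_of_affine_of_stable (Q : ∀ ⦃𝒳 S : SchemeOver ℂ⦄, (𝒳 ⟶ S) → Prop)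
    (hQ : ∀ ⦃𝒳 S S' : SchemeOver ℂ⦄ (f : 𝒳 ⟶ S) (g : S' ⟶ S), IsOpenImmersion g.left →
      Q f → Q (familyPullback.snd f g)) {p M : ℕ}
    (h : ∀ ⦃𝒳 S : SchemeOver ℂ⦄ (f : 𝒳 ⟶ S), IsSmoothProjectiveFamily f (2 * M) → Q f →
      IrreducibleSpace S.left → IsAffine S.left → AlgebraicGeometry.Smooth S.hom →
      ∀ (W : complexBetti 𝒳 (2 * M)),
      (∀ s : ComplexPoints S, IsRationalClass (complexBetti.map (fiberι f s) (2 * M) W) ∧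
        IsOfHodgeType (2 * M) (fiberOver f s) (2 * M) M M (complexBetti.map (fiberι f s) (2 * M) W)) →
      (∀ s : ComplexPoints S, ∃ (A' : AbelianVariety ℂ) (φ' : A' ⟶ A'), A'.dim = (2 * M) ∧
        φ' ≫ φ' = -((p : ℤ) • 𝟙 A') ∧ Nonempty (A'.X ≅ fiberOver f s)) →
      (∃ s₀ : ComplexPoints S,
        complexBetti.map (fiberι f s₀) (2 * M) W ∈ algebraicClasses (fiberOver f s₀) M) →
      ∀ s : ComplexPoints S,
        complexBetti.map (fiberι f s) (2 * M) W ∈ algebraicClasses (fiberOver f s) M)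
    {𝒳 S : SchemeOver ℂ} (f : 𝒳 ⟶ S) (hf : IsSmoothProjectiveFamily f (2 * M)) (hQf : Q f)
    [IrreducibleSpace S.left] [AlgebraicGeometry.Smooth S.hom] (W : complexBetti 𝒳 (2 * M))
    (hW : ∀ s : ComplexPoints S, IsRationalClass (complexBetti.map (fiberι f s) (2 * M) W) ∧
      IsOfHodgeType (2 * M) (fiberOver f s) (2 * M) M M (complexBetti.map (fiberι f s) (2 * M) W))
    (hA : ∀ s : ComplexPoints S, ∃ (A' : AbelianVariety ℂ) (φ' : A' ⟶ A'), A'.dim = (2 * M) ∧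
      φ' ≫ φ' = -((p : ℤ) • 𝟙 A') ∧ Nonempty (A'.X ≅ fiberOver f s))
    (U : S.left.Opens) (hU : IsAffineOpen U) (a b : ComplexPoints S) (haU : a.pt ∈ U) (hbU : b.pt ∈ U)
    (ha : complexBetti.map (fiberι f a) (2 * M) W ∈ algebraicClasses (fiberOver f a) M) :
    complexBetti.map (fiberι f b) (2 * M) W ∈ algebraicClasses (fiberOver f b) M := by
  -- the affine open `U` as a smooth irreducible affine `ℂ`-scheme `g : U ⟶ S`
  haveI : IsOpenImmersion (openSubschemeOverι S U).left := inferInstanceAs (IsOpenImmersion U.ι)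
  have hUaff : IsAffine (openSubschemeOver S U).left := hU
  have hUirr : IrreducibleSpace (openSubschemeOver S U).left := by
    change IrreducibleSpace U
    exact isIrreducible_iff_irreducibleSpace.mp ⟨⟨a.pt, haU⟩,
      (PreirreducibleSpace.isPreirreducible_univ (X := S.left)).open_subset U.isOpen
        (Set.subset_univ _)⟩
  have hUsm : AlgebraicGeometry.Smooth (openSubschemeOver S U).hom := by
    change AlgebraicGeometry.Smooth (U.ι ≫ S.hom)
    infer_instance
  -- lift `a`, `b` to `U`
  have hrange : Set.range (AlgPoints.map (L := ℂ) (openSubschemeOverι S U)) = {P | P.pt ∈ U} := by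
    rw [AlgPoints.range_map_of_isOpenImmersion_holds]
    ext P
    change P.pt ∈ U.ι.opensRange ↔ P.pt ∈ U
    rw [Scheme.Opens.opensRange_ι]
  obtain ⟨a', rfl⟩ : a ∈ Set.range (AlgPoints.map (L := ℂ) (openSubschemeOverι S U)) := by
    rw [hrange]; exact haU
  obtain ⟨b', rfl⟩ : b ∈ Set.range (AlgPoints.map (L := ℂ) (openSubschemeOverι S U)) := by
    rw [hrange]; exact hbU
  -- base change to `U`, apply the affine rung, and come back
  rw [← familyPullback_mem_algebraicClasses_iff (openSubschemeOverι S U) hf M W b']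
  exact h (familyPullback.snd f (openSubschemeOverι S U)) (hf.familyPullback_snd _)
    (hQ f _ inferInstance hQf) hUirr hUaff hUsm
    (complexBetti.map (familyPullback.fst f (openSubschemeOverι S U)) (2 * M) W)
    (familyPullback_fibrewise_rational_hodge f (openSubschemeOverι S U) W hW)
    (familyPullback_fibrewise_weil f (openSubschemeOverι S U) hA)
    ⟨a', (familyPullback_mem_algebraicClasses_iff (openSubschemeOverι S U) hf M W a').2 ha⟩ b'

/-- **Reduction to affine bases for `Q`-families** (`forall_complexPoints_of_affineOpens` +
`weilRung_step_of_affine_of_stable`): the Weil rung `(p, M)` for `Q`-families over smooth irreducible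
affine bases gives it for `Q`-families over all smooth irreducible bases. [folklore] -/
theorem weilRung_of_affine_of_stable (Q : ∀ ⦃𝒳 S : SchemeOver ℂ⦄, (𝒳 ⟶ S) → Prop)
    (hQ : ∀ ⦃𝒳 S S' : SchemeOver ℂ⦄ (f : 𝒳 ⟶ S) (g : S' ⟶ S), IsOpenImmersion g.left →
      Q f → Q (familyPullback.snd f g)) {p M : ℕ}
    (h : ∀ ⦃𝒳 S : SchemeOver ℂ⦄ (f : 𝒳 ⟶ S), IsSmoothProjectiveFamily f (2 * M) → Q f →
      IrreducibleSpace S.left → IsAffine S.left → AlgebraicGeometry.Smooth S.hom →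
      ∀ (W : complexBetti 𝒳 (2 * M)),
      (∀ s : ComplexPoints S, IsRationalClass (complexBetti.map (fiberι f s) (2 * M) W) ∧
        IsOfHodgeType (2 * M) (fiberOver f s) (2 * M) M M (complexBetti.map (fiberι f s) (2 * M) W)) →
      (∀ s : ComplexPoints S, ∃ (A' : AbelianVariety ℂ) (φ' : A' ⟶ A'), A'.dim = (2 * M) ∧
        φ' ≫ φ' = -((p : ℤ) • 𝟙 A') ∧ Nonempty (A'.X ≅ fiberOver f s)) →
      (∃ s₀ : ComplexPoints S,
        complexBetti.map (fiberι f s₀) (2 * M) W ∈ algebraicClasses (fiberOver f s₀) M) →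
      ∀ s : ComplexPoints S,
        complexBetti.map (fiberι f s) (2 * M) W ∈ algebraicClasses (fiberOver f s) M) :
    ∀ ⦃𝒳 S : SchemeOver ℂ⦄ (f : 𝒳 ⟶ S), IsSmoothProjectiveFamily f (2 * M) → Q f →
      IrreducibleSpace S.left → AlgebraicGeometry.Smooth S.hom →
      ∀ (W : complexBetti 𝒳 (2 * M)),
      (∀ s : ComplexPoints S, IsRationalClass (complexBetti.map (fiberι f s) (2 * M) W) ∧
        IsOfHodgeType (2 * M) (fiberOver f s) (2 * M) M M (complexBetti.map (fiberι f s) (2 * M) W)) →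
      (∀ s : ComplexPoints S, ∃ (A' : AbelianVariety ℂ) (φ' : A' ⟶ A'), A'.dim = (2 * M) ∧
        φ' ≫ φ' = -((p : ℤ) • 𝟙 A') ∧ Nonempty (A'.X ≅ fiberOver f s)) →
      (∃ s₀ : ComplexPoints S,
        complexBetti.map (fiberι f s₀) (2 * M) W ∈ algebraicClasses (fiberOver f s₀) M) →
      ∀ s : ComplexPoints S,
        complexBetti.map (fiberι f s) (2 * M) W ∈ algebraicClasses (fiberOver f s) M := by
  intro 𝒳 S f hf hQf hirr hsm W hW hA hs₀ s
  obtain ⟨s₀, hs₀⟩ := hs₀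
  haveI := hirr
  haveI := hsm
  exact forall_complexPoints_of_affineOpens
    (fun t => complexBetti.map (fiberι f t) (2 * M) W ∈ algebraicClasses (fiberOver f t) M)
    (fun U hU a b haU hbU ha =>
      weilRung_step_of_affine_of_stable Q hQ h f hf hQf W hW hA U hU a b haU hbU ha) hs₀ s

/-! ### The rung for quasi-projective total spaces ⟺ the engine-typed core -/

/-- **Core ⇒ rung for quasi-projective total spaces.** If the Weil rung `(p, M)` holds for families that
are projective in Hartshorne's sense over smooth irreducible AFFINE bases (the engine-typed core), it holds
for every family of the crux whose total space is quasi-projective, over any smooth irreducible base: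
reduce to affine bases with `Q 𝒳 := IsQuasiProjectiveOver 𝒳` (stable: `isQuasiProjectiveOver_familyPullback`),
where a proper family with quasi-projective total space is H-projective
(`exists_isClosedImmersion_of_isSmoothProjectiveFamily`). [folklore] -/
theorem weilRung_quasiProjective_of_core {p M : ℕ}
    (hcore : ∀ ⦃𝒳 S : SchemeOver ℂ⦄ (f : 𝒳 ⟶ S), IsSmoothProjectiveFamily f (2 * M) →
      (∃ (N : ℕ) (ι : 𝒳 ⟶ projectiveSpace N ℂ ⊗ S), IsClosedImmersion ι.left ∧
        ι ≫ CartesianMonoidalCategory.snd (projectiveSpace N ℂ) S = f) →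
      IrreducibleSpace S.left → IsAffine S.left → AlgebraicGeometry.Smooth S.hom →
      ∀ (W : complexBetti 𝒳 (2 * M)),
      (∀ s : ComplexPoints S, IsRationalClass (complexBetti.map (fiberι f s) (2 * M) W) ∧
        IsOfHodgeType (2 * M) (fiberOver f s) (2 * M) M M (complexBetti.map (fiberι f s) (2 * M) W)) →
      (∀ s : ComplexPoints S, ∃ (A' : AbelianVariety ℂ) (φ' : A' ⟶ A'), A'.dim = (2 * M) ∧
        φ' ≫ φ' = -((p : ℤ) • 𝟙 A') ∧ Nonempty (A'.X ≅ fiberOver f s)) →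
      (∃ s₀ : ComplexPoints S, complexBetti.map (fiberι f s₀) (2 * M) W ∈ algebraicClasses (fiberOver f s₀) M) →
      ∀ s : ComplexPoints S, complexBetti.map (fiberι f s) (2 * M) W ∈ algebraicClasses (fiberOver f s) M) :
    ∀ ⦃𝒳 S : SchemeOver ℂ⦄ (f : 𝒳 ⟶ S), IsSmoothProjectiveFamily f (2 * M) → IsQuasiProjectiveOver 𝒳 →
      IrreducibleSpace S.left → AlgebraicGeometry.Smooth S.hom →
      ∀ (W : complexBetti 𝒳 (2 * M)),
      (∀ s : ComplexPoints S, IsRationalClass (complexBetti.map (fiberι f s) (2 * M) W) ∧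
        IsOfHodgeType (2 * M) (fiberOver f s) (2 * M) M M (complexBetti.map (fiberι f s) (2 * M) W)) →
      (∀ s : ComplexPoints S, ∃ (A' : AbelianVariety ℂ) (φ' : A' ⟶ A'), A'.dim = (2 * M) ∧
        φ' ≫ φ' = -((p : ℤ) • 𝟙 A') ∧ Nonempty (A'.X ≅ fiberOver f s)) →
      (∃ s₀ : ComplexPoints S, complexBetti.map (fiberι f s₀) (2 * M) W ∈ algebraicClasses (fiberOver f s₀) M) →
      ∀ s : ComplexPoints S, complexBetti.map (fiberι f s) (2 * M) W ∈ algebraicClasses (fiberOver f s) M :=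
  weilRung_of_affine_of_stable (fun 𝒳 _ _ => IsQuasiProjectiveOver 𝒳)
    (fun _ _ _ f g hg h𝒳 => isQuasiProjectiveOver_familyPullback f g hg h𝒳)
    (fun _ _ f hf hq hirr haff hsm W hW hA hs₀ s =>
      hcore f hf (exists_isClosedImmersion_of_isSmoothProjectiveFamily hf hq) hirr haff hsm W hW hA hs₀ s)

/-- **Rung for quasi-projective total spaces ⇒ core.** Over a smooth AFFINE base a family that is
projective in Hartshorne's sense has quasi-projective total space
(`isQuasiProjectiveOver_of_isClosedImmersion_of_isAffine`), so the rung for quasi-projective total spaces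
specialises to the core. [folklore] -/
theorem core_of_weilRung_quasiProjective {p M : ℕ}
    (h : ∀ ⦃𝒳 S : SchemeOver ℂ⦄ (f : 𝒳 ⟶ S), IsSmoothProjectiveFamily f (2 * M) → IsQuasiProjectiveOver 𝒳 →
      IrreducibleSpace S.left → AlgebraicGeometry.Smooth S.hom →
      ∀ (W : complexBetti 𝒳 (2 * M)),
      (∀ s : ComplexPoints S, IsRationalClass (complexBetti.map (fiberι f s) (2 * M) W) ∧
        IsOfHodgeType (2 * M) (fiberOver f s) (2 * M) M M (complexBetti.map (fiberι f s) (2 * M) W)) →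
      (∀ s : ComplexPoints S, ∃ (A' : AbelianVariety ℂ) (φ' : A' ⟶ A'), A'.dim = (2 * M) ∧
        φ' ≫ φ' = -((p : ℤ) • 𝟙 A') ∧ Nonempty (A'.X ≅ fiberOver f s)) →
      (∃ s₀ : ComplexPoints S, complexBetti.map (fiberι f s₀) (2 * M) W ∈ algebraicClasses (fiberOver f s₀) M) →
      ∀ s : ComplexPoints S, complexBetti.map (fiberι f s) (2 * M) W ∈ algebraicClasses (fiberOver f s) M) :
    ∀ ⦃𝒳 S : SchemeOver ℂ⦄ (f : 𝒳 ⟶ S), IsSmoothProjectiveFamily f (2 * M) →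
      (∃ (N : ℕ) (ι : 𝒳 ⟶ projectiveSpace N ℂ ⊗ S), IsClosedImmersion ι.left ∧
        ι ≫ CartesianMonoidalCategory.snd (projectiveSpace N ℂ) S = f) →
      IrreducibleSpace S.left → IsAffine S.left → AlgebraicGeometry.Smooth S.hom →
      ∀ (W : complexBetti 𝒳 (2 * M)),
      (∀ s : ComplexPoints S, IsRationalClass (complexBetti.map (fiberι f s) (2 * M) W) ∧
        IsOfHodgeType (2 * M) (fiberOver f s) (2 * M) M M (complexBetti.map (fiberι f s) (2 * M) W)) →
      (∀ s : ComplexPoints S, ∃ (A' : AbelianVariety ℂ) (φ' : A' ⟶ A'), A'.dim = (2 * M) ∧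
        φ' ≫ φ' = -((p : ℤ) • 𝟙 A') ∧ Nonempty (A'.X ≅ fiberOver f s)) →
      (∃ s₀ : ComplexPoints S, complexBetti.map (fiberι f s₀) (2 * M) W ∈ algebraicClasses (fiberOver f s₀) M) →
      ∀ s : ComplexPoints S, complexBetti.map (fiberι f s) (2 * M) W ∈ algebraicClasses (fiberOver f s) M := by
  intro 𝒳 S f hf hι hirr haff hsm W hW hA hs₀ s
  haveI := haff
  haveI := hsm
  exact h f hf (isQuasiProjectiveOver_of_isClosedImmersion_of_isAffine hι) hirr hsm W hW hA hs₀ s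

/-- **The Weil rung for quasi-projective total spaces (over all smooth irreducible bases) is EQUIVALENT to
the engine-typed core (H-projective families over smooth irreducible affine bases)**, unconditionally
(`weilRung_quasiProjective_of_core`, `core_of_weilRung_quasiProjective`). [folklore] -/
theorem weilRung_quasiProjective_iff_core (p M : ℕ) :
    (∀ ⦃𝒳 S : SchemeOver ℂ⦄ (f : 𝒳 ⟶ S), IsSmoothProjectiveFamily f (2 * M) → IsQuasiProjectiveOver 𝒳 →
      IrreducibleSpace S.left → AlgebraicGeometry.Smooth S.hom →
      ∀ (W : complexBetti 𝒳 (2 * M)),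
      (∀ s : ComplexPoints S, IsRationalClass (complexBetti.map (fiberι f s) (2 * M) W) ∧
        IsOfHodgeType (2 * M) (fiberOver f s) (2 * M) M M (complexBetti.map (fiberι f s) (2 * M) W)) →
      (∀ s : ComplexPoints S, ∃ (A' : AbelianVariety ℂ) (φ' : A' ⟶ A'), A'.dim = (2 * M) ∧
        φ' ≫ φ' = -((p : ℤ) • 𝟙 A') ∧ Nonempty (A'.X ≅ fiberOver f s)) →
      (∃ s₀ : ComplexPoints S, complexBetti.map (fiberι f s₀) (2 * M) W ∈ algebraicClasses (fiberOver f s₀) M) →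
      ∀ s : ComplexPoints S, complexBetti.map (fiberι f s) (2 * M) W ∈ algebraicClasses (fiberOver f s) M) ↔
    (∀ ⦃𝒳 S : SchemeOver ℂ⦄ (f : 𝒳 ⟶ S), IsSmoothProjectiveFamily f (2 * M) →
      (∃ (N : ℕ) (ι : 𝒳 ⟶ projectiveSpace N ℂ ⊗ S), IsClosedImmersion ι.left ∧
        ι ≫ CartesianMonoidalCategory.snd (projectiveSpace N ℂ) S = f) →
      IrreducibleSpace S.left → IsAffine S.left → AlgebraicGeometry.Smooth S.hom →
      ∀ (W : complexBetti 𝒳 (2 * M)),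
      (∀ s : ComplexPoints S, IsRationalClass (complexBetti.map (fiberι f s) (2 * M) W) ∧
        IsOfHodgeType (2 * M) (fiberOver f s) (2 * M) M M (complexBetti.map (fiberι f s) (2 * M) W)) →
      (∀ s : ComplexPoints S, ∃ (A' : AbelianVariety ℂ) (φ' : A' ⟶ A'), A'.dim = (2 * M) ∧
        φ' ≫ φ' = -((p : ℤ) • 𝟙 A') ∧ Nonempty (A'.X ≅ fiberOver f s)) →
      (∃ s₀ : ComplexPoints S, complexBetti.map (fiberι f s₀) (2 * M) W ∈ algebraicClasses (fiberOver f s₀) M) →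
      ∀ s : ComplexPoints S, complexBetti.map (fiberι f s) (2 * M) W ∈ algebraicClasses (fiberOver f s) M) :=
  ⟨core_of_weilRung_quasiProjective, weilRung_quasiProjective_of_core⟩

/-! ### The crux as typed: equivalent to its affine-base restriction; implies the core; converse modulo `hqp` -/

/-- **The crux as typed is equivalent to its restriction to AFFINE bases**: `→` by specialisation, `←` by
the landed affine reduction `stub_affineReduction` (chain of affine opens through a closed point of their
intersection on the irreducible Jacobson base). Restating the crux over affine (hence separated,
quasi-compact, quasi-projective) smooth irreducible bases loses nothing. [folklore] -/
theorem weilVariationalHodge_iff_affineRung :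
    HeckePrymWeil.WeilVariationalHodge ↔
    ∀ p : ℕ, p.Prime → p % 4 = 3 → 7 ≤ p → ∀ M : ℕ, 1 ≤ M →
      ∀ ⦃𝒳 S : SchemeOver ℂ⦄ (f : 𝒳 ⟶ S), IsSmoothProjectiveFamily f (2 * M) → IrreducibleSpace S.left →
      IsAffine S.left → AlgebraicGeometry.Smooth S.hom → ∀ (W : complexBetti 𝒳 (2 * M)),
      (∀ s : ComplexPoints S, IsRationalClass (complexBetti.map (fiberι f s) (2 * M) W) ∧
        IsOfHodgeType (2 * M) (fiberOver f s) (2 * M) M M (complexBetti.map (fiberι f s) (2 * M) W)) →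
      (∀ s : ComplexPoints S, ∃ (A' : AbelianVariety ℂ) (φ' : A' ⟶ A'), A'.dim = (2 * M) ∧
        φ' ≫ φ' = -((p : ℤ) • 𝟙 A') ∧ Nonempty (A'.X ≅ fiberOver f s)) →
      (∃ s₀ : ComplexPoints S, complexBetti.map (fiberι f s₀) (2 * M) W ∈ algebraicClasses (fiberOver f s₀) M) →
      ∀ s : ComplexPoints S, complexBetti.map (fiberι f s) (2 * M) W ∈ algebraicClasses (fiberOver f s) M :=
  ⟨fun hV p hp hp4 hp7 M hM _ _ f hf hirr _ hsm W hW hA hs₀ s =>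
    hV p hp hp4 hp7 M hM f hf hirr hsm W hW hA hs₀ s,
   fun h p hp hp4 hp7 M hM => stub_affineReduction p M (h p hp hp4 hp7 M hM)⟩

/-- **The crux as typed implies the engine-typed core** (drop the embedding and the affineness of the
base). [folklore] -/
theorem projectiveCore_of_weilVariationalHodge (hV : HeckePrymWeil.WeilVariationalHodge) :
    ∀ p : ℕ, p.Prime → p % 4 = 3 → 7 ≤ p → ∀ M : ℕ, 1 ≤ M →
      ∀ ⦃𝒳 S : SchemeOver ℂ⦄ (f : 𝒳 ⟶ S), IsSmoothProjectiveFamily f (2 * M) →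
      (∃ (N : ℕ) (ι : 𝒳 ⟶ projectiveSpace N ℂ ⊗ S), IsClosedImmersion ι.left ∧
        ι ≫ CartesianMonoidalCategory.snd (projectiveSpace N ℂ) S = f) →
      IrreducibleSpace S.left → IsAffine S.left → AlgebraicGeometry.Smooth S.hom →
      ∀ (W : complexBetti 𝒳 (2 * M)),
      (∀ s : ComplexPoints S, IsRationalClass (complexBetti.map (fiberι f s) (2 * M) W) ∧
        IsOfHodgeType (2 * M) (fiberOver f s) (2 * M) M M (complexBetti.map (fiberι f s) (2 * M) W)) →
      (∀ s : ComplexPoints S, ∃ (A' : AbelianVariety ℂ) (φ' : A' ⟶ A'), A'.dim = (2 * M) ∧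
        φ' ≫ φ' = -((p : ℤ) • 𝟙 A') ∧ Nonempty (A'.X ≅ fiberOver f s)) →
      (∃ s₀ : ComplexPoints S, complexBetti.map (fiberι f s₀) (2 * M) W ∈ algebraicClasses (fiberOver f s₀) M) →
      ∀ s : ComplexPoints S, complexBetti.map (fiberι f s) (2 * M) W ∈ algebraicClasses (fiberOver f s) M :=
  fun p hp hp4 hp7 M hM _ _ f hf _ hirr _ hsm W hW hA hs₀ s =>
    hV p hp hp4 hp7 M hM f hf hirr hsm W hW hA hs₀ s

/-- **Core ⇒ crux as typed, GRANTED quasi-projectivity of para-abelian total spaces** (hypothesis `hqp`: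
the total space of a smooth proper family with abelian complex fibres over a smooth irreducible affine base
is quasi-projective — true on paper by étale-local sections, Raynaud 1970 XI 1.4 / V 3.10 =
Görtz–Wedhorn II Thm. 27.291 / 27.71, not in the tree): reduce to affine bases (`stub_affineReduction`),
where `hqp` makes the total space quasi-projective and `weilRung_quasiProjective_of_core` applies. This is
the composition `WeilVariationalHodge_of` of skeleton v2 with its two open stubs as hypotheses. [folklore] -/
theorem weilVariationalHodge_of_projectiveCore
    (hqp : ∀ (M : ℕ) ⦃𝒳 S : SchemeOver ℂ⦄ (f : 𝒳 ⟶ S), IsSmoothProjectiveFamily f (2 * M) →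
      IrreducibleSpace S.left → IsAffine S.left → AlgebraicGeometry.Smooth S.hom →
      (∀ s : ComplexPoints S, ∃ A' : AbelianVariety ℂ, Nonempty (A'.X ≅ fiberOver f s)) →
      IsQuasiProjectiveOver 𝒳)
    (hcore : ∀ p : ℕ, p.Prime → p % 4 = 3 → 7 ≤ p → ∀ M : ℕ, 1 ≤ M →
      ∀ ⦃𝒳 S : SchemeOver ℂ⦄ (f : 𝒳 ⟶ S), IsSmoothProjectiveFamily f (2 * M) →
      (∃ (N : ℕ) (ι : 𝒳 ⟶ projectiveSpace N ℂ ⊗ S), IsClosedImmersion ι.left ∧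
        ι ≫ CartesianMonoidalCategory.snd (projectiveSpace N ℂ) S = f) →
      IrreducibleSpace S.left → IsAffine S.left → AlgebraicGeometry.Smooth S.hom →
      ∀ (W : complexBetti 𝒳 (2 * M)),
      (∀ s : ComplexPoints S, IsRationalClass (complexBetti.map (fiberι f s) (2 * M) W) ∧
        IsOfHodgeType (2 * M) (fiberOver f s) (2 * M) M M (complexBetti.map (fiberι f s) (2 * M) W)) →
      (∀ s : ComplexPoints S, ∃ (A' : AbelianVariety ℂ) (φ' : A' ⟶ A'), A'.dim = (2 * M) ∧
        φ' ≫ φ' = -((p : ℤ) • 𝟙 A') ∧ Nonempty (A'.X ≅ fiberOver f s)) →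
      (∃ s₀ : ComplexPoints S, complexBetti.map (fiberι f s₀) (2 * M) W ∈ algebraicClasses (fiberOver f s₀) M) →
      ∀ s : ComplexPoints S, complexBetti.map (fiberι f s) (2 * M) W ∈ algebraicClasses (fiberOver f s) M) :
    HeckePrymWeil.WeilVariationalHodge := by
  intro p hp hp4 hp7 M hM
  refine stub_affineReduction p M fun 𝒳 S f hf hirr haff hsm W hW hA hs₀ s => ?_
  have h𝒳 : IsQuasiProjectiveOver 𝒳 :=
    hqp M f hf hirr haff hsm fun t => by
      obtain ⟨A', -, -, -, e⟩ := hA t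
      exact ⟨A', e⟩
  exact weilRung_quasiProjective_of_core (hcore p hp hp4 hp7 M hM) f hf h𝒳 hirr hsm W hW hA hs₀ s

/-- **Crux as typed ⟺ engine-typed core, granted `hqp`** (`projectiveCore_of_weilVariationalHodge`,
`weilVariationalHodge_of_projectiveCore`): modulo quasi-projectivity of para-abelian total spaces the crux
is exactly Grothendieck's variational Hodge statement for middle-degree classes along H-PROJECTIVE families
of abelian `2M`-folds with `√-p`-multiplication over smooth irreducible affine bases. [folklore] -/
theorem weilVariationalHodge_iff_projectiveCore
    (hqp : ∀ (M : ℕ) ⦃𝒳 S : SchemeOver ℂ⦄ (f : 𝒳 ⟶ S), IsSmoothProjectiveFamily f (2 * M) →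
      IrreducibleSpace S.left → IsAffine S.left → AlgebraicGeometry.Smooth S.hom →
      (∀ s : ComplexPoints S, ∃ A' : AbelianVariety ℂ, Nonempty (A'.X ≅ fiberOver f s)) →
      IsQuasiProjectiveOver 𝒳) :
    HeckePrymWeil.WeilVariationalHodge ↔
    ∀ p : ℕ, p.Prime → p % 4 = 3 → 7 ≤ p → ∀ M : ℕ, 1 ≤ M →
      ∀ ⦃𝒳 S : SchemeOver ℂ⦄ (f : 𝒳 ⟶ S), IsSmoothProjectiveFamily f (2 * M) →
      (∃ (N : ℕ) (ι : 𝒳 ⟶ projectiveSpace N ℂ ⊗ S), IsClosedImmersion ι.left ∧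
        ι ≫ CartesianMonoidalCategory.snd (projectiveSpace N ℂ) S = f) →
      IrreducibleSpace S.left → IsAffine S.left → AlgebraicGeometry.Smooth S.hom →
      ∀ (W : complexBetti 𝒳 (2 * M)),
      (∀ s : ComplexPoints S, IsRationalClass (complexBetti.map (fiberι f s) (2 * M) W) ∧
        IsOfHodgeType (2 * M) (fiberOver f s) (2 * M) M M (complexBetti.map (fiberι f s) (2 * M) W)) →
      (∀ s : ComplexPoints S, ∃ (A' : AbelianVariety ℂ) (φ' : A' ⟶ A'), A'.dim = (2 * M) ∧
        φ' ≫ φ' = -((p : ℤ) • 𝟙 A') ∧ Nonempty (A'.X ≅ fiberOver f s)) →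
      (∃ s₀ : ComplexPoints S, complexBetti.map (fiberι f s₀) (2 * M) W ∈ algebraicClasses (fiberOver f s₀) M) →
      ∀ s : ComplexPoints S, complexBetti.map (fiberι f s) (2 * M) W ∈ algebraicClasses (fiberOver f s) M :=
  ⟨projectiveCore_of_weilVariationalHodge, weilVariationalHodge_of_projectiveCore hqp⟩

/-- **The crux restricted to quasi-projective total spaces is equivalent to the engine-typed core,
unconditionally** (all `p`, `M` with the side conditions at once; `weilRung_quasiProjective_iff_core`
rung by rung): the restatement of stmt-HodgeConjecture-14497 that every printed engine addresses.
[folklore] -/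
theorem weilVariationalHodge_quasiProjective_iff_projectiveCore :
    (∀ p : ℕ, p.Prime → p % 4 = 3 → 7 ≤ p → ∀ M : ℕ, 1 ≤ M →
      ∀ ⦃𝒳 S : SchemeOver ℂ⦄ (f : 𝒳 ⟶ S), IsSmoothProjectiveFamily f (2 * M) → IsQuasiProjectiveOver 𝒳 →
      IrreducibleSpace S.left → AlgebraicGeometry.Smooth S.hom →
      ∀ (W : complexBetti 𝒳 (2 * M)),
      (∀ s : ComplexPoints S, IsRationalClass (complexBetti.map (fiberι f s) (2 * M) W) ∧
        IsOfHodgeType (2 * M) (fiberOver f s) (2 * M) M M (complexBetti.map (fiberι f s) (2 * M) W)) →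
      (∀ s : ComplexPoints S, ∃ (A' : AbelianVariety ℂ) (φ' : A' ⟶ A'), A'.dim = (2 * M) ∧
        φ' ≫ φ' = -((p : ℤ) • 𝟙 A') ∧ Nonempty (A'.X ≅ fiberOver f s)) →
      (∃ s₀ : ComplexPoints S, complexBetti.map (fiberι f s₀) (2 * M) W ∈ algebraicClasses (fiberOver f s₀) M) →
      ∀ s : ComplexPoints S, complexBetti.map (fiberι f s) (2 * M) W ∈ algebraicClasses (fiberOver f s) M) ↔
    ∀ p : ℕ, p.Prime → p % 4 = 3 → 7 ≤ p → ∀ M : ℕ, 1 ≤ M →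
      ∀ ⦃𝒳 S : SchemeOver ℂ⦄ (f : 𝒳 ⟶ S), IsSmoothProjectiveFamily f (2 * M) →
      (∃ (N : ℕ) (ι : 𝒳 ⟶ projectiveSpace N ℂ ⊗ S), IsClosedImmersion ι.left ∧
        ι ≫ CartesianMonoidalCategory.snd (projectiveSpace N ℂ) S = f) →
      IrreducibleSpace S.left → IsAffine S.left → AlgebraicGeometry.Smooth S.hom →
      ∀ (W : complexBetti 𝒳 (2 * M)),
      (∀ s : ComplexPoints S, IsRationalClass (complexBetti.map (fiberι f s) (2 * M) W) ∧
        IsOfHodgeType (2 * M) (fiberOver f s) (2 * M) M M (complexBetti.map (fiberι f s) (2 * M) W)) →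
      (∀ s : ComplexPoints S, ∃ (A' : AbelianVariety ℂ) (φ' : A' ⟶ A'), A'.dim = (2 * M) ∧
        φ' ≫ φ' = -((p : ℤ) • 𝟙 A') ∧ Nonempty (A'.X ≅ fiberOver f s)) →
      (∃ s₀ : ComplexPoints S, complexBetti.map (fiberι f s₀) (2 * M) W ∈ algebraicClasses (fiberOver f s₀) M) →
      ∀ s : ComplexPoints S, complexBetti.map (fiberι f s) (2 * M) W ∈ algebraicClasses (fiberOver f s) M :=
  ⟨fun h p hp hp4 hp7 M hM => core_of_weilRung_quasiProjective (h p hp hp4 hp7 M hM),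
   fun h p hp hp4 hp7 M hM => weilRung_quasiProjective_of_core (h p hp hp4 hp7 M hM)⟩

end Summit.HodgeConjecture.HodgeConjecture.Theorems

end
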